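import Literature.Computability.Complexity.HamCircuitNP
import Literature.Computability.Complexity.IndexAllBricks
import Literature.Computability.Complexity.PlumbingBricks
import Literature.Computability.Complexity.ListFoldChecks
import Literature.Computability.Complexity.NPClosureProofs
import Literature.GroupTheory.CombinatorialGroupTheory.CommutatorLengthNP
import HarnessLib

/-!
# CL-`F_r` is in `NP` (Heuer 2020, Cor. 2.5), I: the pairing verifier in the `FP` string algebra

Machine half of the `NP`-membership conjunct of the named fact `Heuer2020_clNPComplete`
(`CommutatorLengthNP.lean`; N. Heuer, *Computing commutator length is hard*, arXiv:2001.10230,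
Cor. 2.5: "given a chain `w` and an integer `n ∈ ℕ`, we may verify that `cl_F(w) ≤ n` by providing
an appropriate pairing `π ∈ Π_w`. Computing the number of orbits can be done in linear time in
`|w|`. Thus we may verify `cl_F(w)` in polynomial time"). Following the tree's `HamCircuitNP.lean`
(`HAMCIRCUIT ∈ NP`: a code language in `P` intersected with a certificate language over a `P`
verifier), this file builds, in the algebra of `FP` string functions (no machine is written):

* **the instance-code test** `CLNP.codeT r ∈ FP` (one bit): `codeT r x = [1]` iff
  `x = clInstanceCode r (w, k)` for some word `w : List (Fin r × Bool)` and `k : ℕ`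
  (`codeT_true_iff`: the pair splits, the threshold is unary, the word length is a multiple of
  `r + 1` — `Plumb.divModFn` — and every `(r+1)`-block is one of the `2r` letter codes —
  `Brick.allIdxFn` over `anyFn eqPairFn` against the constant list `codesList r`; decoding
  `exists_clWordCode_eq`); whence `codeLang r ∈ P`;
* **the certificate**: a pairing `π` of the positions of `w`, coded as the canonical list
  `HamNP.listCode [π 0, …, π (n-1)]` of unary numerals (as the vertex list of `HamCircuitNP`);
* **the verifier** `CLNP.verifT r ∈ FP` (one bit) on `⟨x, y⟩`: accept iff the word is empty, or
  `y` is a canonical list code (`CanonCode.canonListFn onesFn`) of exactly `n = |w|` items below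
  `n` (`lenYT`, `ltT`) forming a fixed-point-free involution (`invT`: `l[l[j]] = j ≠ l[j]`, two
  `HashBricks.nthItemFn` look-ups under `Brick.allIdxFn`) pairing inverse letters (`letT`: equal
  one-hot parts and different blocks, `Plumb.takeFn`/`dropFn`/`umulFn`), and the genus inequality
  `n + 2 ≤ 4k + 2·orb` (`ineqT`, unary lengths compared by `Brick.ltLenF`), where
  **`orb = #cycles of τ`, `τ j = l[(j+1) mod n]`** (the vertex permutation `σπ`), is computed as
  the number of cycle-minima: `CLNP.cntU` folds (`Brick.foldLoop appF`) the indicators of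
  "`j ≤ τᵗ j` for all `t < n`" (`minC`, an `allIdxFn`), the iterate `τᵗ j` being produced by the
  counted loop `Brick.loopStep` of the body `tauBody` (`Plumb.wrapSucc` then `nthItemFn`), `|w|`
  clocked rounds;
* **the truth of the verifier** on the code of ANY instance paired with ANY string,
  `verifT_code_true_iff`: `w = []`, or `y = listCode l` with `GoodCert w k l` (the list conditions
  and `n + 2 ≤ 4k + 2 cntL l`, `cntL` the number of cycle-minima); `verifLang r ∈ P`.

The identification of `GoodCert` with "`l` is a pairing of `w` with `|w|/2 + 1 ≤ 2k + orb(σπ)`"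
(cycle-minima count the cycles) and the assembly `clLanguage r ∈ NP` through the certificate
characterisation of `clDecisionSet` (`CommutatorLengthCertificate.lean`) are the sequel file.

## References

* [Heuer2020] N. Heuer, *Computing commutator length is hard*, arXiv:2001.10230, §1 (CL-`G`),
  Cor. 2.5.
* [AroraBarakCC2009] S. Arora, B. Barak, *Computational Complexity: A Modern Approach*, CUP 2009,
  Def. 2.1 (`NP` by certificates), Def. 1.13, §1.3 (closure of polynomial time under composition
  and bounded loops), §0.1 (codes of pairs and lists).
-/

noncomputable section

namespace Literature.GroupTheory.CombinatorialGroupTheory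

namespace CLNP

open _root_.Computability Literature.Computability.Complexity Literature.Computability.Complexity.Brick
  Literature.Computability.Complexity.HashBricks Literature.Computability.Complexity.Plumb
  Literature.Computability.Complexity.OracleCompose Polynomial

/-! ### Letter codes and word codes as lists -/

variable (r : ℕ)

/-- The `2r` letter codes of `F(Fin r)`, as a list. [folklore] -/
def codesList : List (List Bool) :=
  (List.finRange r).flatMap fun a => [clLetterCode r (a, true), clLetterCode r (a, false)]

/-- Membership in `codesList`. [folklore] -/
theorem mem_codesList_iff (B : List Bool) : B ∈ codesList r ↔ ∃ x : Fin r × Bool, B = clLetterCode r x := by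
  unfold codesList
  simp only [List.mem_flatMap, List.mem_finRange, true_and, List.mem_cons, List.not_mem_nil, or_false]
  constructor
  · rintro ⟨a, h | h⟩
    · exact ⟨(a, true), h⟩
    · exact ⟨(a, false), h⟩
  · rintro ⟨⟨a, b⟩, rfl⟩
    refine ⟨a, ?_⟩
    cases b
    · exact Or.inr rfl
    · exact Or.inl rfl

/-- The length of a word code. [folklore] -/
theorem length_clWordCode (w : List (Fin r × Bool)) : (clWordCode r w).length = (r + 1) * w.length := by
  induction w with
  | nil => simp [clWordCode]
  | cons x w ih =>
    simp only [clWordCode, List.flatMap_cons, List.length_append, length_clLetterCode, List.length_cons] at ih ⊢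
    rw [ih]
    ring

/-- The word code of a cons. [folklore] -/
theorem clWordCode_cons (x : Fin r × Bool) (w : List (Fin r × Bool)) :
    clWordCode r (x :: w) = clLetterCode r x ++ clWordCode r w := by
  simp [clWordCode]

/-- Block `i` of a word code is the code of letter `i`. [folklore] -/
theorem take_drop_clWordCode (w : List (Fin r × Bool)) :
    ∀ (i : ℕ) (hi : i < w.length),
      ((clWordCode r w).drop (i * (r + 1))).take (r + 1) = clLetterCode r (w[i]) := by
  induction w with
  | nil => intro i hi; simp at hi
  | cons x w ih =>
    intro i hi
    cases i with
    | zero =>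
      rw [clWordCode_cons, Nat.zero_mul, List.drop_zero, List.take_left' (length_clLetterCode r x)]
      rfl
    | succ i =>
      have hlen : (clLetterCode r x).length = r + 1 := length_clLetterCode r x
      rw [clWordCode_cons, show (i + 1) * (r + 1) = (r + 1) + i * (r + 1) by ring, ← List.drop_drop,
        List.drop_left' hlen, ih i (by simpa using hi)]
      rfl

/-- **Decoding**: a string whose `(r+1)`-blocks are all letter codes is a word code. [folklore] -/
theorem exists_clWordCode_eq : ∀ (n : ℕ) (W : List Bool), W.length = (r + 1) * n →
    (∀ i < n, (W.drop (i * (r + 1))).take (r + 1) ∈ codesList r) →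
      ∃ w : List (Fin r × Bool), w.length = n ∧ clWordCode r w = W := by
  intro n
  induction n with
  | zero =>
    intro W hW _
    refine ⟨[], rfl, ?_⟩
    rw [Nat.mul_zero, List.length_eq_zero_iff] at hW
    rw [hW]
    rfl
  | succ n ih =>
    intro W hW hblk
    have h0 := hblk 0 (Nat.succ_pos n)
    rw [Nat.zero_mul, List.drop_zero] at h0
    obtain ⟨x, hx⟩ := (mem_codesList_iff r _).1 h0
    have hsplit : W = W.take (r + 1) ++ W.drop (r + 1) := (List.take_append_drop _ _).symm
    have hlen' : (W.drop (r + 1)).length = (r + 1) * n := by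
      rw [List.length_drop, hW]
      ring_nf
      omega
    have hblk' : ∀ i < n, ((W.drop (r + 1)).drop (i * (r + 1))).take (r + 1) ∈ codesList r := by
      intro i hi
      have := hblk (i + 1) (by omega)
      rwa [show (i + 1) * (r + 1) = (r + 1) + i * (r + 1) by ring, ← List.drop_drop] at this
    obtain ⟨w, hwlen, hw⟩ := ih (W.drop (r + 1)) hlen' hblk'
    refine ⟨x :: w, by simp [hwlen], ?_⟩
    rw [clWordCode_cons, hw, ← hx]
    exact hsplit.symm

/-- `ones` is `onesFn` of itself; `onesFn w = 1^{|w|}`. [folklore] -/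
theorem onesFn_eq (w : List Bool) : onesFn w = ones w.length := by
  rw [onesFn, OracleCompose.unaryEncodeNat_eq_replicate]

/-- A string is unary iff it equals `onesFn` of itself. [folklore] -/
theorem eq_onesFn_iff (U : List Bool) : U = onesFn U ↔ ∃ k, U = unaryEncodeNat k := by
  rw [onesFn]
  constructor
  · intro h
    exact ⟨U.length, h⟩
  · rintro ⟨k, rfl⟩
    simp [OracleCompose.unaryEncodeNat_eq_replicate]

/-! ### Projections and the unary word length `1ⁿ` -/

/-- On an instance `x = ⟨W, U⟩`: the unary number of letters `1^{|W| / (r+1)}`. [folklore] -/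
def nU : List Bool → List Bool := fstF ∘ divModFn ∘ fanoutFn (fun _ => ones (r + 1)) (onesFn ∘ fstF)

/-- `nU ∈ FP`. [cite: AroraBarakCC2009, §1.3] -/
theorem nU_mem_FP : nU r ∈ FP :=
  comp_mem_FP fstF_mem_FP (comp_mem_FP divModFn_mem_FP
    (fanoutFn_mem_FP (const_mem_FP _) (comp_mem_FP onesFn_mem_FP fstF_mem_FP)))

/-- Value of `nU`. [folklore] -/
theorem nU_apply (x : List Bool) : nU r x = ones ((fstF x).length / (r + 1)) := by
  simp [nU, onesFn_eq]

/-- The yardstick fits: `|nU x| ≤ |x|`. [folklore] -/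
theorem length_nU_le (x : List Bool) : (nU r x).length ≤ x.length := by
  rw [nU_apply, List.length_replicate]
  have h1 := length_fstF_sndF_le x
  have h2 : (fstF x).length / (r + 1) ≤ (fstF x).length := Nat.div_le_self _ _
  omega

/-- On a record `⟨x, u⟩`: the `(r+1)`-block of `W = fstF x` starting at letter position `|u|`. [folklore] -/
def blkAt : List Bool → List Bool :=
  takeFn ∘ fanoutFn (fun _ => ones (r + 1))
    (dropFn ∘ fanoutFn (umulFn ∘ fanoutFn sndF (fun _ => ones (r + 1))) (fstF ∘ fstF))

/-- `blkAt ∈ FP`. [cite: AroraBarakCC2009, §1.3] -/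
theorem blkAt_mem_FP : blkAt r ∈ FP :=
  comp_mem_FP takeFn_mem_FP (fanoutFn_mem_FP (const_mem_FP _)
    (comp_mem_FP dropFn_mem_FP (fanoutFn_mem_FP
      (comp_mem_FP umulFn_mem_FP (fanoutFn_mem_FP sndF_mem_FP (const_mem_FP _)))
      (comp_mem_FP fstF_mem_FP fstF_mem_FP))))

/-- Value of `blkAt` on a record. [folklore] -/
theorem blkAt_boolPair (x u : List Bool) :
    blkAt r (boolPair x u) = ((fstF x).drop (u.length * (r + 1))).take (r + 1) := by
  simp [blkAt, umulFn_apply]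

/-! ### The instance-code test -/

/-- `[x = ⟨fstF x, sndF x⟩]`. [folklore] -/
def t1a : List Bool → List Bool := eqPairFn ∘ fanoutFn id (fanoutFn fstF sndF)
/-- `[U is unary]`. [folklore] -/
def t1b : List Bool → List Bool := eqPairFn ∘ fanoutFn sndF (onesFn ∘ sndF)
/-- `[|W| ≡ 0 mod (r+1)]`. [folklore] -/
def t1c : List Bool → List Bool :=
  isNilFn ∘ sndF ∘ divModFn ∘ fanoutFn (fun _ => ones (r + 1)) (onesFn ∘ fstF)
/-- On `⟨x, 1ⁱ⟩`: `[block i of W is a letter code]` (membership in the constant list of codes). [folklore] -/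
def blkOkC : List Bool → List Bool :=
  anyFn (eqPairFn ∘ fanoutFn (blkAt r ∘ fstF) sndF) ∘ fanoutFn id (fun _ => encList (codesList r))
/-- `[every block of W is a letter code]`. [folklore] -/
def t1d : List Bool → List Bool := allIdxFn (nU r) (blkOkC r)

/-- **The instance-code test**: `x` is `clInstanceCode r (w, k)` for some `(w, k)`. [folklore] -/
def codeT : List Bool → List Bool := andFn t1a (andFn t1b (andFn (t1c r) (t1d r)))

/-- `t1a ∈ FP`. [cite: AroraBarakCC2009, §1.3] -/
theorem t1a_mem_FP : t1a ∈ FP :=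
  comp_mem_FP eqPairFn_mem_FP (fanoutFn_mem_FP id_mem_FP (fanoutFn_mem_FP fstF_mem_FP sndF_mem_FP))
/-- `t1b ∈ FP`. [cite: AroraBarakCC2009, §1.3] -/
theorem t1b_mem_FP : t1b ∈ FP :=
  comp_mem_FP eqPairFn_mem_FP (fanoutFn_mem_FP sndF_mem_FP (comp_mem_FP onesFn_mem_FP sndF_mem_FP))
/-- `t1c ∈ FP`. [cite: AroraBarakCC2009, §1.3] -/
theorem t1c_mem_FP : t1c r ∈ FP :=
  comp_mem_FP isNilFn_mem_FP (comp_mem_FP sndF_mem_FP (comp_mem_FP divModFn_mem_FP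
    (fanoutFn_mem_FP (const_mem_FP _) (comp_mem_FP onesFn_mem_FP fstF_mem_FP))))
/-- `blkOkC ∈ FP`. [cite: AroraBarakCC2009, §1.3] -/
theorem blkOkC_mem_FP : blkOkC r ∈ FP :=
  comp_mem_FP (anyFn_mem_FP (comp_mem_FP eqPairFn_mem_FP
    (fanoutFn_mem_FP (comp_mem_FP (blkAt_mem_FP r) fstF_mem_FP) sndF_mem_FP)) (oneBit_eqPairFn.comp _))
    (fanoutFn_mem_FP id_mem_FP (const_mem_FP _))
/-- `blkOkC` is one-bit. [folklore] -/
theorem oneBit_blkOkC : OneBit (blkOkC r) := (oneBit_anyFn (oneBit_eqPairFn.comp _)).comp _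
/-- `t1d ∈ FP`. [cite: AroraBarakCC2009, §1.3] -/
theorem t1d_mem_FP : t1d r ∈ FP := allIdxFn_mem_FP (nU_mem_FP r) (blkOkC_mem_FP r) (oneBit_blkOkC r)
/-- **`codeT ∈ FP`.** [cite: AroraBarakCC2009, §1.3] -/
theorem codeT_mem_FP : codeT r ∈ FP :=
  andFn_mem_FP t1a_mem_FP (andFn_mem_FP t1b_mem_FP (andFn_mem_FP (t1c_mem_FP r) (t1d_mem_FP r)))

/-- `t1a` is one-bit. [folklore] -/
theorem oneBit_t1a : OneBit t1a := oneBit_eqPairFn.comp _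
/-- `t1b` is one-bit. [folklore] -/
theorem oneBit_t1b : OneBit t1b := oneBit_eqPairFn.comp _
/-- `t1c` is one-bit. [folklore] -/
theorem oneBit_t1c : OneBit (t1c r) := oneBit_isNilFn.comp _
/-- `t1d` is one-bit. [folklore] -/
theorem oneBit_t1d : OneBit (t1d r) := oneBit_allIdxFn (oneBit_blkOkC r) (length_nU_le r)
/-- `codeT` is one-bit. [folklore] -/
theorem oneBit_codeT : OneBit (codeT r) :=
  oneBit_andFn oneBit_t1a (oneBit_andFn oneBit_t1b (oneBit_andFn (oneBit_t1c r) (oneBit_t1d r)))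

/-- Truth of `blkOkC` on a record. [folklore] -/
theorem blkOkC_true_iff (x : List Bool) (i : ℕ) :
    blkOkC r (boolPair x (ones i)) = [true] ↔ ((fstF x).drop (i * (r + 1))).take (r + 1) ∈ codesList r := by
  rw [blkOkC, Function.comp_apply, fanoutFn_apply, anyFn_boolPair_eq_true (oneBit_eqPairFn.comp _), decNil_encList]
  simp only [id_eq, Function.comp_apply, fanoutFn_apply, fstF_boolPair, sndF_boolPair, blkAt_boolPair,
    List.length_replicate, eqPairFn_boolPair_eq_true]
  constructor
  · rintro ⟨a, ha, h⟩
    rw [h]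
    exact ha
  · intro h
    exact ⟨_, h, rfl⟩

/-- **Truth of the instance-code test**: `codeT r x = [1]` iff `x` is an instance code. [folklore] -/
theorem codeT_true_iff (x : List Bool) :
    codeT r x = [true] ↔ ∃ (w : List (Fin r × Bool)) (k : ℕ), x = clInstanceCode r (w, k) := by
  rw [codeT, andFn_eq_true_iff oneBit_t1a (oneBit_andFn oneBit_t1b (oneBit_andFn (oneBit_t1c r) (oneBit_t1d r))),
    andFn_eq_true_iff oneBit_t1b (oneBit_andFn (oneBit_t1c r) (oneBit_t1d r)),
    andFn_eq_true_iff (oneBit_t1c r) (oneBit_t1d r)]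
  have h1a : t1a x = [true] ↔ x = boolPair (fstF x) (sndF x) := by
    rw [t1a, Function.comp_apply, fanoutFn_apply, fanoutFn_apply, eqPairFn_boolPair_eq_true]
    rfl
  have h1b : t1b x = [true] ↔ sndF x = onesFn (sndF x) := by
    rw [t1b, Function.comp_apply, fanoutFn_apply, eqPairFn_boolPair_eq_true]
    rfl
  have h1c : t1c r x = [true] ↔ (fstF x).length % (r + 1) = 0 := by
    rw [t1c]
    simp only [Function.comp_apply, fanoutFn_apply, onesFn_eq, divModFn_boolPair, sndF_boolPair,
      isNilFn_eq_true_iff]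
    rw [show ones ((fstF x).length % (r + 1)) = [] ↔ (fstF x).length % (r + 1) = 0 from by
      rw [← List.length_eq_zero_iff, List.length_replicate]]
  have h1d : t1d r x = [true] ↔ ∀ i < (fstF x).length / (r + 1),
      ((fstF x).drop (i * (r + 1))).take (r + 1) ∈ codesList r := by
    rw [t1d, allIdxFn_apply (oneBit_blkOkC r) (length_nU_le r x), nU_apply, List.length_replicate,
      HamNP.singleton_decide_eq_true_iff]
    exact forall_congr' fun i => imp_congr_right fun _ => blkOkC_true_iff r x i
  rw [h1a, h1b, h1c, h1d]
  constructor
  · rintro ⟨ha, hb, hc, hd⟩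
    have hlen : (fstF x).length = (r + 1) * ((fstF x).length / (r + 1)) :=
      (Nat.mul_div_cancel' (Nat.dvd_of_mod_eq_zero hc)).symm
    obtain ⟨w, -, hw⟩ := exists_clWordCode_eq r _ (fstF x) hlen hd
    obtain ⟨k, hk⟩ := (eq_onesFn_iff _).1 hb
    refine ⟨w, k, ?_⟩
    rw [ha, clInstanceCode, hw, hk]
  · rintro ⟨w, k, rfl⟩
    have hf : fstF (clInstanceCode r (w, k)) = clWordCode r w := by simp [clInstanceCode]
    have hs : sndF (clInstanceCode r (w, k)) = unaryEncodeNat k := by simp [clInstanceCode]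
    refine ⟨?_, ?_, ?_, ?_⟩
    · rw [hf, hs]
      rfl
    · rw [hs]
      exact (eq_onesFn_iff _).2 ⟨k, rfl⟩
    · rw [hf, length_clWordCode, Nat.mul_mod_right]
    · intro i hi
      rw [hf] at hi ⊢
      rw [length_clWordCode, Nat.mul_div_cancel_left _ (Nat.succ_pos r)] at hi
      rw [take_drop_clWordCode r w i hi]
      exact (mem_codesList_iff r _).2 ⟨_, rfl⟩

/-- **The language of instance codes** is in `P`. [cite: AroraBarakCC2009, Def. 1.13 and §1.3] -/
def codeLang : Language Bool := {x | codeT r x = [true]}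

/-- `codeLang ∈ P`. [cite: AroraBarakCC2009, §1.3] -/
theorem codeLang_mem_P : codeLang r ∈ Classes.P := CliqueNP.mem_P_of_oneBit (codeT_mem_FP r) (oneBit_codeT r)

/-- Membership in `codeLang`. [folklore] -/
theorem mem_codeLang_iff (x : List Bool) :
    x ∈ codeLang r ↔ ∃ (w : List (Fin r × Bool)) (k : ℕ), x = clInstanceCode r (w, k) :=
  codeT_true_iff r x

/-! ### The certificate: a canonical list of unary numerals `listCode l` (as for `HAMCIRCUIT`) -/

/-- On `w = ⟨x, y⟩`: `1ⁿ`, `n` the number of letters of the instance. [folklore] -/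
def nW : List Bool → List Bool := nU r ∘ fstF
/-- The header of the certificate (`1^{|l|}` on a list code). [folklore] -/
def hdrY : List Bool → List Bool := fstF ∘ sndF
/-- The items of the certificate. [folklore] -/
def itemsY : List Bool → List Bool := sndF ∘ sndF

/-- `nW ∈ FP`. [cite: AroraBarakCC2009, §1.3] -/
theorem nW_mem_FP : nW r ∈ FP := comp_mem_FP (nU_mem_FP r) fstF_mem_FP
/-- `hdrY ∈ FP`. [cite: AroraBarakCC2009, §1.3] -/
theorem hdrY_mem_FP : hdrY ∈ FP := comp_mem_FP fstF_mem_FP sndF_mem_FP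
/-- `itemsY ∈ FP`. [cite: AroraBarakCC2009, §1.3] -/
theorem itemsY_mem_FP : itemsY ∈ FP := comp_mem_FP sndF_mem_FP sndF_mem_FP

/-- The yardstick `nW` fits. [folklore] -/
theorem length_nW_le (w : List Bool) : (nW r w).length ≤ w.length :=
  (length_nU_le r (fstF w)).trans (by have := length_fstF_sndF_le w; omega)

section Values

variable {r}
variable (w : List (Fin r × Bool)) (k : ℕ) (y : List Bool)

/-- The instance code, field by field. [folklore] -/
theorem fstF_code : fstF (clInstanceCode r (w, k)) = clWordCode r w := by simp [clInstanceCode]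
/-- The instance code, field by field. [folklore] -/
theorem sndF_code : sndF (clInstanceCode r (w, k)) = ones k := by
  simp [clInstanceCode, OracleCompose.unaryEncodeNat_eq_replicate]
/-- Value of `nU` on an instance code: `1ⁿ`. [folklore] -/
theorem nU_code : nU r (clInstanceCode r (w, k)) = ones w.length := by
  rw [nU_apply, fstF_code, length_clWordCode, Nat.mul_div_cancel_left _ (Nat.succ_pos r)]
/-- Value of `nW`. [folklore] -/
@[simp] theorem nW_pair : nW r (boolPair (clInstanceCode r (w, k)) y) = ones w.length := by
  rw [nW, Function.comp_apply, fstF_boolPair, nU_code]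
/-- Value of `hdrY`. [folklore] -/
@[simp] theorem hdrY_pair (x : List Bool) : hdrY (boolPair x y) = fstF y := by simp [hdrY]
/-- Value of `itemsY`. [folklore] -/
@[simp] theorem itemsY_pair (x : List Bool) : itemsY (boolPair x y) = sndF y := by simp [itemsY]

/-- Item `j` of the item list of a list code. [folklore] -/
theorem fstF_sndF_iterate_items (l : List ℕ) (j : ℕ) (hj : j < l.length) :
    fstF (sndF^[j] (encList (l.map ones))) = ones (l[j]) := by
  rw [Brick.sndF_iterate_encList, Brick.fstF_encList, ← List.map_drop,
    List.drop_eq_getElem_cons hj]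
  rfl

end Values

/-! ### The list tests: empty word, canonical certificate, length, range -/

/-- `[the word is empty]`. [folklore] -/
def emptyT : List Bool → List Bool := isNilFn ∘ fstF ∘ fstF
/-- `[the certificate has n items]`. [folklore] -/
def lenYT : List Bool → List Bool := eqPairFn ∘ fanoutFn hdrY (nW r)
/-- `[every item is shorter than 1ⁿ]`. [folklore] -/
def ltT : List Bool → List Bool := allFn (ltLenF ∘ fanoutFn sndF fstF) ∘ fanoutFn (nW r) itemsY

/-- `emptyT ∈ FP`. [cite: AroraBarakCC2009, §1.3] -/
theorem emptyT_mem_FP : emptyT ∈ FP := comp_mem_FP isNilFn_mem_FP (comp_mem_FP fstF_mem_FP fstF_mem_FP)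
/-- `lenYT ∈ FP`. [cite: AroraBarakCC2009, §1.3] -/
theorem lenYT_mem_FP : lenYT r ∈ FP := comp_mem_FP eqPairFn_mem_FP (fanoutFn_mem_FP hdrY_mem_FP (nW_mem_FP r))
/-- `ltT ∈ FP`. [cite: AroraBarakCC2009, §1.3] -/
theorem ltT_mem_FP : ltT r ∈ FP :=
  comp_mem_FP (allFn_mem_FP (comp_mem_FP ltLenF_mem_FP (fanoutFn_mem_FP sndF_mem_FP fstF_mem_FP))
    (oneBit_ltLenF.comp _)) (fanoutFn_mem_FP (nW_mem_FP r) itemsY_mem_FP)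

/-- `emptyT` is one-bit. [folklore] -/
theorem oneBit_emptyT : OneBit emptyT := oneBit_isNilFn.comp _
/-- `lenYT` is one-bit. [folklore] -/
theorem oneBit_lenYT : OneBit (lenYT r) := oneBit_eqPairFn.comp _
/-- `ltT` is one-bit. [folklore] -/
theorem oneBit_ltT : OneBit (ltT r) := (oneBit_allFn (oneBit_ltLenF.comp _)).comp _

section Truth

variable {r}
variable (w : List (Fin r × Bool)) (k : ℕ)

/-- Truth of `emptyT`. [folklore] -/
theorem emptyT_true_iff (y : List Bool) :
    emptyT (boolPair (clInstanceCode r (w, k)) y) = [true] ↔ w = [] := by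
  rw [emptyT, Function.comp_apply, Function.comp_apply, fstF_boolPair, fstF_code, isNilFn_eq_true_iff,
    ← List.length_eq_zero_iff, length_clWordCode, ← List.length_eq_zero_iff]
  constructor
  · intro h
    have : (r + 1) * w.length = 0 := h
    simpa using this
  · intro h
    rw [h, Nat.mul_zero]

variable (l : List ℕ)

/-- Truth of `lenYT` on a list code. [folklore] -/
theorem lenYT_true_iff :
    lenYT r (boolPair (clInstanceCode r (w, k)) (HamNP.listCode l)) = [true] ↔ l.length = w.length := by
  rw [lenYT, Function.comp_apply, fanoutFn_apply, hdrY_pair, nW_pair, HamNP.listCode_eq, fstF_boolPair,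
    eqPairFn_boolPair, HamNP.singleton_decide_eq_true_iff, CliqueNP.ones_inj]

/-- Truth of `ltT` on a list code. [folklore] -/
theorem ltT_true_iff :
    ltT r (boolPair (clInstanceCode r (w, k)) (HamNP.listCode l)) = [true] ↔ ∀ v ∈ l, v < w.length := by
  rw [ltT, Function.comp_apply, fanoutFn_apply, nW_pair, itemsY_pair, HamNP.listCode_eq, sndF_boolPair,
    allFn_boolPair_eq_true (oneBit_ltLenF.comp _), decNil_encList]
  simp [ones]

end Truth

/-! ### The pairing tests: involution without fixed points, inverse letters -/

/-- On `⟨w, 1ʲ⟩`: item `j` of the certificate (`1^{l[j]}`). [folklore] -/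
def itJ : List Bool → List Bool := nthItemFn ∘ fanoutFn sndF (itemsY ∘ fstF)
/-- On `⟨w, 1ʲ⟩`: item `l[j]` of the certificate (`1^{l[l[j]]}`). [folklore] -/
def itPJ : List Bool → List Bool := nthItemFn ∘ fanoutFn itJ (itemsY ∘ fstF)
/-- The per-index involution test `[l[l[j]] = j ∧ l[j] ≠ j]`. [folklore] -/
def invC : List Bool → List Bool :=
  andFn (eqPairFn ∘ fanoutFn itPJ sndF) (notFn (eqPairFn ∘ fanoutFn itJ sndF))
/-- `[the certificate is a fixed-point-free involution]`. [folklore] -/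
def invT : List Bool → List Bool := allIdxFn (nW r) invC

/-- On `⟨w, 1ʲ⟩`: the block of letter `j`. [folklore] -/
def blkJ : List Bool → List Bool := blkAt r ∘ fanoutFn (fstF ∘ fstF) sndF
/-- On `⟨w, 1ʲ⟩`: the block of letter `l[j]`. [folklore] -/
def blkPJ : List Bool → List Bool := blkAt r ∘ fanoutFn (fstF ∘ fstF) itJ
/-- The per-index letter test `[letters j and l[j] have the same generator and opposite signs]`:
equal one-hot parts, different blocks. [folklore] -/
def letC : List Bool → List Bool :=
  andFn (eqPairFn ∘ fanoutFn (takeFn ∘ fanoutFn (fun _ => ones r) (blkJ r))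
    (takeFn ∘ fanoutFn (fun _ => ones r) (blkPJ r))) (notFn (eqPairFn ∘ fanoutFn (blkJ r) (blkPJ r)))
/-- `[every position is paired with an inverse letter]`. [folklore] -/
def letT : List Bool → List Bool := allIdxFn (nW r) (letC r)

/-- `itJ ∈ FP`. [cite: AroraBarakCC2009, §1.3] -/
theorem itJ_mem_FP : itJ ∈ FP :=
  comp_mem_FP nthItemFn_mem_FP (fanoutFn_mem_FP sndF_mem_FP (comp_mem_FP itemsY_mem_FP fstF_mem_FP))
/-- `itPJ ∈ FP`. [cite: AroraBarakCC2009, §1.3] -/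
theorem itPJ_mem_FP : itPJ ∈ FP :=
  comp_mem_FP nthItemFn_mem_FP (fanoutFn_mem_FP itJ_mem_FP (comp_mem_FP itemsY_mem_FP fstF_mem_FP))
/-- `invC ∈ FP`. [cite: AroraBarakCC2009, §1.3] -/
theorem invC_mem_FP : invC ∈ FP :=
  andFn_mem_FP (comp_mem_FP eqPairFn_mem_FP (fanoutFn_mem_FP itPJ_mem_FP sndF_mem_FP))
    (notFn_mem_FP (comp_mem_FP eqPairFn_mem_FP (fanoutFn_mem_FP itJ_mem_FP sndF_mem_FP)))
/-- `invC` is one-bit. [folklore] -/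
theorem oneBit_invC : OneBit invC :=
  oneBit_andFn (oneBit_eqPairFn.comp _) (oneBit_notFn (oneBit_eqPairFn.comp _))
/-- `invT ∈ FP`. [cite: AroraBarakCC2009, §1.3] -/
theorem invT_mem_FP : invT r ∈ FP := allIdxFn_mem_FP (nW_mem_FP r) invC_mem_FP oneBit_invC
/-- `invT` is one-bit. [folklore] -/
theorem oneBit_invT : OneBit (invT r) := oneBit_allIdxFn oneBit_invC (length_nW_le r)
/-- `blkJ ∈ FP`. [cite: AroraBarakCC2009, §1.3] -/
theorem blkJ_mem_FP : blkJ r ∈ FP :=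
  comp_mem_FP (blkAt_mem_FP r) (fanoutFn_mem_FP (comp_mem_FP fstF_mem_FP fstF_mem_FP) sndF_mem_FP)
/-- `blkPJ ∈ FP`. [cite: AroraBarakCC2009, §1.3] -/
theorem blkPJ_mem_FP : blkPJ r ∈ FP :=
  comp_mem_FP (blkAt_mem_FP r) (fanoutFn_mem_FP (comp_mem_FP fstF_mem_FP fstF_mem_FP) itJ_mem_FP)
/-- `letC ∈ FP`. [cite: AroraBarakCC2009, §1.3] -/
theorem letC_mem_FP : letC r ∈ FP :=
  andFn_mem_FP (comp_mem_FP eqPairFn_mem_FP (fanoutFn_mem_FP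
    (comp_mem_FP takeFn_mem_FP (fanoutFn_mem_FP (const_mem_FP _) (blkJ_mem_FP r)))
    (comp_mem_FP takeFn_mem_FP (fanoutFn_mem_FP (const_mem_FP _) (blkPJ_mem_FP r)))))
    (notFn_mem_FP (comp_mem_FP eqPairFn_mem_FP (fanoutFn_mem_FP (blkJ_mem_FP r) (blkPJ_mem_FP r))))
/-- `letC` is one-bit. [folklore] -/
theorem oneBit_letC : OneBit (letC r) :=
  oneBit_andFn (oneBit_eqPairFn.comp _) (oneBit_notFn (oneBit_eqPairFn.comp _))
/-- `letT ∈ FP`. [cite: AroraBarakCC2009, §1.3] -/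
theorem letT_mem_FP : letT r ∈ FP := allIdxFn_mem_FP (nW_mem_FP r) (letC_mem_FP r) (oneBit_letC r)
/-- `letT` is one-bit. [folklore] -/
theorem oneBit_letT : OneBit (letT r) := oneBit_allIdxFn (oneBit_letC r) (length_nW_le r)

section TruthPairing

variable {r}
variable (w : List (Fin r × Bool)) (k : ℕ) (l : List ℕ)

/-- Value of `itJ` at an index below `|l|`. [folklore] -/
theorem itJ_pair {j : ℕ} (hj : j < l.length) :
    itJ (boolPair (boolPair (clInstanceCode r (w, k)) (HamNP.listCode l)) (ones j)) = ones (l[j]) := by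
  rw [itJ, Function.comp_apply, fanoutFn_apply, sndF_boolPair, Function.comp_apply, fstF_boolPair, itemsY_pair,
    HamNP.listCode_eq, sndF_boolPair, nthItemFn_boolPair, List.length_replicate, fstF_sndF_iterate_items l j hj]

/-- Value of `itPJ` at an index below `|l|` whose item is below `|l|`. [folklore] -/
theorem itPJ_pair {j : ℕ} (hj : j < l.length) (hlj : l[j] < l.length) :
    itPJ (boolPair (boolPair (clInstanceCode r (w, k)) (HamNP.listCode l)) (ones j)) = ones (l[l[j]]) := by
  rw [itPJ, Function.comp_apply, fanoutFn_apply, itJ_pair w k l hj, Function.comp_apply, fstF_boolPair,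
    itemsY_pair, HamNP.listCode_eq, sndF_boolPair, nthItemFn_boolPair, List.length_replicate,
    fstF_sndF_iterate_items l _ hlj]

/-- Truth of `invC` at an index below `|l|` whose item is below `|l|`. [folklore] -/
theorem invC_true_iff {j : ℕ} (hj : j < l.length) (hlj : l[j] < l.length) :
    invC (boolPair (boolPair (clInstanceCode r (w, k)) (HamNP.listCode l)) (ones j)) = [true] ↔
      l[l[j]] = j ∧ l[j] ≠ j := by
  have h1 : (eqPairFn ∘ fanoutFn itPJ sndF) (boolPair (boolPair (clInstanceCode r (w, k)) (HamNP.listCode l))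
      (ones j)) = [decide (l[l[j]] = j)] := by
    rw [Function.comp_apply, fanoutFn_apply, itPJ_pair w k l hj hlj, sndF_boolPair, eqPairFn_boolPair,
      Bool.decide_congr CliqueNP.ones_inj]
  have h2 : (notFn (eqPairFn ∘ fanoutFn itJ sndF)) (boolPair (boolPair (clInstanceCode r (w, k))
      (HamNP.listCode l)) (ones j)) = [!decide (l[j] = j)] := by
    rw [notFn_apply]
    rw [Function.comp_apply, fanoutFn_apply, itJ_pair w k l hj, sndF_boolPair, eqPairFn_boolPair,
      Bool.decide_congr CliqueNP.ones_inj]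
  rw [invC, andFn_apply h1 h2]
  simp

/-- Truth of `invT` on a list code with `n` items below `n`. [folklore] -/
theorem invT_true_iff (hl : l.length = w.length) (h : ∀ v ∈ l, v < w.length) :
    invT r (boolPair (clInstanceCode r (w, k)) (HamNP.listCode l)) = [true] ↔
      ∀ (j : ℕ) (hj : j < l.length),
        l[l[j]]'(by rw [hl]; exact h _ (List.getElem_mem hj)) = j ∧ l[j] ≠ j := by
  rw [invT, allIdxFn_apply oneBit_invC (length_nW_le r _), nW_pair, List.length_replicate,
    HamNP.singleton_decide_eq_true_iff]
  constructor
  · intro H j hj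
    have := H j (hl ▸ hj)
    rwa [invC_true_iff w k l hj (by have := h _ (List.getElem_mem hj); omega)] at this
  · intro H j hj
    rw [invC_true_iff w k l (hl ▸ hj) (by have := h (l[j]'(hl ▸ hj)) (List.getElem_mem _); omega)]
    exact H j (hl ▸ hj)

/-- The one-hot part of a letter code. [folklore] -/
theorem take_clLetterCode (x : Fin r × Bool) :
    (clLetterCode r x).take r = List.ofFn fun j : Fin r => decide (x.1 = j) := by
  rw [clLetterCode, List.take_left' (List.length_ofFn)]

/-- Two letter codes have equal one-hot parts and are different iff the letters are inverse to each
other. [folklore] -/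
theorem letters_inverse_iff (x z : Fin r × Bool) :
    ((clLetterCode r x).take r = (clLetterCode r z).take r ∧ clLetterCode r x ≠ clLetterCode r z) ↔
      z = (x.1, !x.2) := by
  rw [take_clLetterCode, take_clLetterCode]
  constructor
  · rintro ⟨h1, h2⟩
    have hf := List.ofFn_inj.mp h1
    have ha : decide (x.1 = x.1) = decide (z.1 = x.1) := congrFun hf x.1
    simp only [decide_true, Bool.true_eq, decide_eq_true_eq] at ha
    have hb : z.2 ≠ x.2 := by
      intro hb
      apply h2
      rw [show z = x from Prod.ext ha hb]
    refine Prod.ext ha ?_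
    cases hz : z.2 <;> cases hx : x.2 <;> simp_all
  · rintro rfl
    refine ⟨?_, fun h => ?_⟩
    · rfl
    · have := (clLetterCode_injective r h)
      have := congrArg Prod.snd this
      simp at this

/-- Value of `blkJ` at an index below `n`. [folklore] -/
theorem blkJ_pair (y : List Bool) {j : ℕ} (hj : j < w.length) :
    blkJ r (boolPair (boolPair (clInstanceCode r (w, k)) y) (ones j)) = clLetterCode r (w[j]) := by
  simp only [blkJ, Function.comp_apply, fanoutFn_apply, fstF_boolPair, sndF_boolPair, blkAt_boolPair, fstF_code,
    List.length_replicate]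
  exact take_drop_clWordCode r w j hj

/-- Value of `blkPJ` at an index below `|l|` whose item is below `n`. [folklore] -/
theorem blkPJ_pair {j : ℕ} (hj : j < l.length) (hlj : l[j] < w.length) :
    blkPJ r (boolPair (boolPair (clInstanceCode r (w, k)) (HamNP.listCode l)) (ones j)) =
      clLetterCode r (w[l[j]]) := by
  rw [blkPJ, Function.comp_apply, fanoutFn_apply, itJ_pair w k l hj]
  simp only [Function.comp_apply, fstF_boolPair, blkAt_boolPair, fstF_code, List.length_replicate]
  exact take_drop_clWordCode r w _ hlj

/-- Truth of `letC`. [folklore] -/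
theorem letC_true_iff {j : ℕ} (hj : j < l.length) (hjw : j < w.length) (hlj : l[j] < w.length) :
    letC r (boolPair (boolPair (clInstanceCode r (w, k)) (HamNP.listCode l)) (ones j)) = [true] ↔
      w[l[j]] = ((w[j]).1, !(w[j]).2) := by
  set z := boolPair (boolPair (clInstanceCode r (w, k)) (HamNP.listCode l)) (ones j) with hz
  have hb1 : blkJ r z = clLetterCode r (w[j]) := blkJ_pair w k _ hjw
  have hb2 : blkPJ r z = clLetterCode r (w[l[j]]) := blkPJ_pair w k l hj hlj
  have h1 : (eqPairFn ∘ fanoutFn (takeFn ∘ fanoutFn (fun _ => ones r) (blkJ r))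
      (takeFn ∘ fanoutFn (fun _ => ones r) (blkPJ r))) z =
      [decide ((clLetterCode r (w[j])).take r = (clLetterCode r (w[l[j]])).take r)] := by
    simp only [Function.comp_apply, fanoutFn_apply, hb1, hb2, takeFn_boolPair, List.length_replicate,
      eqPairFn_boolPair]
  have h2 : (notFn (eqPairFn ∘ fanoutFn (blkJ r) (blkPJ r))) z =
      [!decide (clLetterCode r (w[j]) = clLetterCode r (w[l[j]]))] := by
    rw [notFn_apply]
    simp only [Function.comp_apply, fanoutFn_apply, hb1, hb2, eqPairFn_boolPair]
  rw [letC, andFn_apply h1 h2, ← letters_inverse_iff]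
  simp

/-- Truth of `letT` on a list code with `n` items below `n`. [folklore] -/
theorem letT_true_iff (hl : l.length = w.length) (h : ∀ v ∈ l, v < w.length) :
    letT r (boolPair (clInstanceCode r (w, k)) (HamNP.listCode l)) = [true] ↔
      ∀ (j : ℕ) (hj : j < l.length),
        w[l[j]]'(h _ (List.getElem_mem hj)) =
          ((w[j]'(by rw [← hl]; exact hj)).1, !(w[j]'(by rw [← hl]; exact hj)).2) := by
  rw [letT, allIdxFn_apply (oneBit_letC r) (length_nW_le r _), nW_pair, List.length_replicate,
    HamNP.singleton_decide_eq_true_iff]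
  constructor
  · intro H j hj
    have := H j (hl ▸ hj)
    rwa [letC_true_iff w k l hj (hl ▸ hj) (h _ (List.getElem_mem hj))] at this
  · intro H j hj
    rw [letC_true_iff w k l (hl ▸ hj) hj (h _ (List.getElem_mem _))]
    exact H j (hl ▸ hj)

end TruthPairing

/-! ### The orbit count: minima of the cycles of `τ j = l[(j+1) mod n]`

The vertex permutation of Heuer's `σπ` (as `(finRotate n).trans π`) is, on the certificate
`l`, the map `τ j = l[(j + 1) mod n]`. Its number of cycles is the number of `j < n` that are
minimal on their cycle, `j ≤ τ^t j` for all `t < n`; the verifier computes `τ^t j` by a counted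
loop and counts the minimal `j` in unary. -/

/-- The specification of `τ` on a list: `τ j = l[(j + 1) mod |l|]` (junk `0` out of range). [folklore] -/
def tauL (l : List ℕ) (m : ℕ) : ℕ := l.getD ((m + 1) % l.length) 0

/-- `j` is minimal on its `τ`-cycle (tested over `|l|` iterates). [folklore] -/
def IsMinL (l : List ℕ) (j : ℕ) : Prop := ∀ t < l.length, j ≤ (tauL l)^[t] j

/-- `IsMinL` is decidable. [folklore] -/
instance (l : List ℕ) (j : ℕ) : Decidable (IsMinL l j) := by unfold IsMinL; infer_instance

/-- The number of cycle-minima below `|l|`. [folklore] -/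
def cntL (l : List ℕ) : ℕ := ((List.range l.length).filter fun j => decide (IsMinL l j)).length

/-- `τ` takes values in the list. [folklore] -/
theorem tauL_lt {l : List ℕ} {n : ℕ} (hl : l.length = n) (h : ∀ v ∈ l, v < n) (hn : 0 < n) (m : ℕ) :
    tauL l m < n := by
  unfold tauL
  have hidx : (m + 1) % l.length < l.length := by rw [hl]; exact Nat.mod_lt _ hn
  rw [List.getD_eq_getElem _ _ hidx]
  exact h _ (List.getElem_mem _)

/-- Iterates of `τ` stay in range. [folklore] -/
theorem tauL_iterate_lt {l : List ℕ} {n : ℕ} (hl : l.length = n) (h : ∀ v ∈ l, v < n) {j : ℕ} (hj : j < n) :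
    ∀ t : ℕ, (tauL l)^[t] j < n
  | 0 => hj
  | t + 1 => by
    rw [Function.iterate_succ_apply']
    exact tauL_lt hl h (by omega) _

/-- The body of the `τ`-loop, on records `⟨w, ⟨counter, 1^cur⟩⟩`: `1^{l[(cur+1) mod n]}`. [folklore] -/
def tauBody : List Bool → List Bool :=
  nthItemFn ∘ fanoutFn (wrapSucc ∘ fanoutFn (nW r ∘ nthF 0) (sndPow 1)) (itemsY ∘ nthF 0)

/-- `tauBody ∈ FP`. [cite: AroraBarakCC2009, §1.3] -/
theorem tauBody_mem_FP : tauBody r ∈ FP :=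
  comp_mem_FP nthItemFn_mem_FP (fanoutFn_mem_FP
    (comp_mem_FP wrapSucc_mem_FP (fanoutFn_mem_FP (comp_mem_FP (nW_mem_FP r) (nthF_mem_FP 0)) (sndPow_mem_FP 1)))
    (comp_mem_FP itemsY_mem_FP (nthF_mem_FP 0)))

/-- **Growth of the body** (on every input): an item of the certificate, so at most `|w|` symbols.
[folklore] -/
theorem length_tauBody_le (z : List Bool) :
    (tauBody r z).length ≤ (sndPow 1 z).length + 1 * ((fstF z).length + 1) := by
  rw [tauBody, Function.comp_apply, fanoutFn_apply, nthItemFn_boolPair]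
  set u := (wrapSucc ∘ fanoutFn (nW r ∘ nthF 0) (sndPow 1)) z with hu
  set W' := (itemsY ∘ nthF 0) z with hW'
  have h1 := length_fstF_sndF_le (sndF^[u.length] W')
  have h2 := Brick.length_sndF_iterate_le u.length W'
  have h3 : W'.length ≤ (fstF z).length := by
    rw [hW']
    simp only [Function.comp_apply, itemsY, nthF_zero]
    have a := length_fstF_sndF_le (fstF z)
    have b := length_fstF_sndF_le (sndF (fstF z))
    omega
  omega

section TauValues

variable {r}
variable (w : List (Fin r × Bool)) (k : ℕ) (l : List ℕ)

/-- Value of the body on a loop record over a list code with `n` items below `n`. [folklore] -/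
theorem tauBody_record (hl : l.length = w.length) (c : List Bool) {cur : ℕ} (hcur : cur < w.length) :
    tauBody r (boolPair (boolPair (clInstanceCode r (w, k)) (HamNP.listCode l)) (boolPair c (ones cur))) =
      ones (tauL l cur) := by
  have hn : 0 < w.length := by omega
  rw [tauBody, Function.comp_apply, fanoutFn_apply]
  simp only [Function.comp_apply, fanoutFn_apply, nthF_zero, fstF_boolPair, nW_pair, sndPow_succ_boolPair,
    sndPow_zero_boolPair, wrapSucc_boolPair, itemsY_pair, HamNP.listCode_eq, sndF_boolPair, nthItemFn_boolPair,
    List.length_replicate]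
  have hidx : (if cur + 1 = w.length then 0 else cur + 1) = (cur + 1) % l.length := by
    rw [hl]
    split_ifs with hc
    · rw [hc, Nat.mod_self]
    · rw [Nat.mod_eq_of_lt (by omega)]
  rw [hidx, fstF_sndF_iterate_items l _ (by rw [hl]; exact Nat.mod_lt _ hn)]
  unfold tauL
  rw [List.getD_eq_getElem]

/-- The loop model of the body: `t` applications of `τ`. [folklore] -/
theorem loopModel_tauBody (hl : l.length = w.length) (h : ∀ v ∈ l, v < w.length) :
    ∀ (t : ℕ) {j : ℕ}, j < w.length →
      loopModel (tauBody r) (boolPair (clInstanceCode r (w, k)) (HamNP.listCode l)) t (ones j) =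
        ones ((tauL l)^[t] j)
  | 0, j, _ => rfl
  | t + 1, j, hj => by
    rw [loopModel, tauBody_record w k l hl _ hj, loopModel_tauBody hl h t (tauL_lt hl h (by omega) j),
      Function.iterate_succ_apply]

end TauValues

/-- On `⟨⟨w, 1ʲ⟩, 1ᵗ⟩`: the loop record `⟨w, ⟨bin t, 1ʲ⟩⟩`. [folklore] -/
def tauInit : List Bool → List Bool := fanoutFn (fstF ∘ fstF) (fanoutFn (lenBinF ∘ sndF) (sndF ∘ fstF))
/-- The clocked `τ`-loop (`|w|` rounds available). [cite: AroraBarakCC2009, §1.3 (bounded loops)] -/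
def tauLoop : List Bool → List Bool := fun z => (loopStep (tauBody r))^[X.eval (fstF z).length] z
/-- On `⟨⟨w, 1ʲ⟩, 1ᵗ⟩`: `1^{τ^t j}`. [folklore] -/
def tauPow : List Bool → List Bool := sndPow 1 ∘ tauLoop r ∘ tauInit

/-- `tauInit ∈ FP`. [cite: AroraBarakCC2009, §1.3] -/
theorem tauInit_mem_FP : tauInit ∈ FP :=
  fanoutFn_mem_FP (comp_mem_FP fstF_mem_FP fstF_mem_FP)
    (fanoutFn_mem_FP (comp_mem_FP lenBinF_mem_FP sndF_mem_FP) (comp_mem_FP sndF_mem_FP fstF_mem_FP))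
/-- `tauLoop ∈ FP`. [cite: AroraBarakCC2009, §1.3 (bounded loops)] -/
theorem tauLoop_mem_FP : tauLoop r ∈ FP := loopFn_mem_FP (tauBody_mem_FP r) (length_tauBody_le r) X
/-- `tauPow ∈ FP`. [cite: AroraBarakCC2009, §1.3] -/
theorem tauPow_mem_FP : tauPow r ∈ FP :=
  comp_mem_FP (sndPow_mem_FP 1) (comp_mem_FP (tauLoop_mem_FP r) tauInit_mem_FP)

section TauPowValues

variable {r}
variable (w : List (Fin r × Bool)) (k : ℕ) (l : List ℕ)

/-- `n ≤ |⟨x, y⟩|` for the code `x` of an instance with `n` letters. [folklore] -/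
theorem length_le_pair (y : List Bool) : w.length ≤ (boolPair (clInstanceCode r (w, k)) y).length := by
  rw [length_boolPair, clInstanceCode, length_boolPair, length_clWordCode]
  nlinarith

/-- **Value of `tauPow`**: `1^{τ^t j}` for `j < n`, `t ≤ n`. [folklore] -/
theorem tauPow_apply (hl : l.length = w.length) (h : ∀ v ∈ l, v < w.length) {j t : ℕ} (hj : j < w.length)
    (ht : t ≤ w.length) :
    tauPow r (boolPair (boolPair (boolPair (clInstanceCode r (w, k)) (HamNP.listCode l)) (ones j)) (ones t)) =
      ones ((tauL l)^[t] j) := by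
  have hinit : tauInit (boolPair (boolPair (boolPair (clInstanceCode r (w, k)) (HamNP.listCode l)) (ones j))
      (ones t)) = boolPair (boolPair (clInstanceCode r (w, k)) (HamNP.listCode l))
        (boolPair (encodeNat t) (ones j)) := by
    simp [tauInit]
  rw [tauPow, Function.comp_apply, Function.comp_apply, hinit, tauLoop]
  simp only [fstF_boolPair, eval_X]
  rw [iterate_loopStep (tauBody r) _ t _ (ones j) (ht.trans (length_le_pair w k _)), sndPow_succ_boolPair,
    sndPow_zero_boolPair, loopModel_tauBody w k l hl h t hj]

end TauPowValues

/-- On `⟨⟨w, 1ʲ⟩, 1ᵗ⟩`: `[¬ (τ^t j < j)]`. [folklore] -/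
def geC : List Bool → List Bool := notFn (ltLenF ∘ fanoutFn (tauPow r) (sndF ∘ fstF))
/-- On `⟨w, 1ʲ⟩`: `[j is minimal on its τ-cycle]`. [folklore] -/
def minC : List Bool → List Bool := allIdxFn (nW r ∘ fstF) (geC r)
/-- On `⟨w, 1ʲ⟩`: the indicator `1` / `ε` of minimality. [folklore] -/
def minInd : List Bool → List Bool := iteFn (minC r) (fun _ => [true]) (fun _ => [])
/-- **On `w`: the unary count `1^{#minima}` of the cycles of `τ`.** [folklore] -/
def cntU : List Bool → List Bool :=
  sndPow 2 ∘ foldLoop appF (minInd r) X ∘ fanoutFn id (fanoutFn (lenBinF ∘ nW r) fun _ => boolPair [] [])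

/-- `geC ∈ FP`. [cite: AroraBarakCC2009, §1.3] -/
theorem geC_mem_FP : geC r ∈ FP :=
  notFn_mem_FP (comp_mem_FP ltLenF_mem_FP (fanoutFn_mem_FP (tauPow_mem_FP r) (comp_mem_FP sndF_mem_FP fstF_mem_FP)))
/-- `geC` is one-bit. [folklore] -/
theorem oneBit_geC : OneBit (geC r) := oneBit_notFn (oneBit_ltLenF.comp _)
/-- The inner yardstick fits. [folklore] -/
theorem length_nW_fstF_le (z : List Bool) : ((nW r ∘ fstF) z).length ≤ z.length :=
  (length_nW_le r (fstF z)).trans (by have := length_fstF_sndF_le z; omega)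
/-- `minC ∈ FP`. [cite: AroraBarakCC2009, §1.3] -/
theorem minC_mem_FP : minC r ∈ FP :=
  allIdxFn_mem_FP (comp_mem_FP (nW_mem_FP r) fstF_mem_FP) (geC_mem_FP r) (oneBit_geC r)
/-- `minC` is one-bit. [folklore] -/
theorem oneBit_minC : OneBit (minC r) := oneBit_allIdxFn (oneBit_geC r) (length_nW_fstF_le r)
/-- `minInd ∈ FP`. [cite: AroraBarakCC2009, §1.3] -/
theorem minInd_mem_FP : minInd r ∈ FP := iteFn_mem_FP (minC_mem_FP r) (const_mem_FP _) (const_mem_FP _)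
/-- The indicator is at most one symbol, on every input. [folklore] -/
theorem length_minInd_le (z : List Bool) : (minInd r z).length ≤ 1 * ((fstF z).length + 1) := by
  rw [minInd, iteFn_of_oneBit (oneBit_minC r)]
  split_ifs <;> simp
/-- The value of the indicator. [folklore] -/
theorem minInd_apply (z : List Bool) : minInd r z = if minC r z = [true] then [true] else [] := by
  rw [minInd, iteFn_of_oneBit (oneBit_minC r)]
/-- **`cntU ∈ FP`.** [cite: AroraBarakCC2009, §1.3 (bounded loops)] -/
theorem cntU_mem_FP : cntU r ∈ FP :=
  comp_mem_FP (sndPow_mem_FP 2) (comp_mem_FP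
    (foldLoop_mem_FP appF_mem_FP length_appF_le (minInd_mem_FP r) (length_minInd_le r) X)
    (fanoutFn_mem_FP id_mem_FP (fanoutFn_mem_FP (comp_mem_FP lenBinF_mem_FP (nW_mem_FP r)) (const_mem_FP _))))

/-- The concatenation of indicator bits is a unary count. [folklore] -/
theorem ccat_indicator (P : ℕ → Prop) [DecidablePred P] :
    ∀ n : ℕ, ccat (fun j => if P j then [true] else []) n = ones (((List.range n).filter fun j => decide (P j)).length)
  | 0 => rfl
  | n + 1 => by
    rw [ccat_succ, ccat_indicator P n, List.range_succ, List.filter_append, List.length_append]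
    by_cases hP : P n
    · rw [if_pos hP]
      simp [hP, ones, List.replicate_add]
    · rw [if_neg hP]
      simp [hP]

section CountValues

variable {r}
variable (w : List (Fin r × Bool)) (k : ℕ) (l : List ℕ)

/-- Truth of `geC`. [folklore] -/
theorem geC_true_iff (hl : l.length = w.length) (h : ∀ v ∈ l, v < w.length) {j t : ℕ} (hj : j < w.length)
    (ht : t ≤ w.length) :
    geC r (boolPair (boolPair (boolPair (clInstanceCode r (w, k)) (HamNP.listCode l)) (ones j)) (ones t)) =
      [true] ↔ j ≤ (tauL l)^[t] j := by
  rw [geC, notFn_apply (b := decide ((tauL l)^[t] j < j))]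
  · simp
  · rw [Function.comp_apply, fanoutFn_apply, tauPow_apply w k l hl h hj ht]
    simp

/-- Truth of `minC`: minimality on the cycle. [folklore] -/
theorem minC_true_iff (hl : l.length = w.length) (h : ∀ v ∈ l, v < w.length) {j : ℕ} (hj : j < w.length) :
    minC r (boolPair (boolPair (clInstanceCode r (w, k)) (HamNP.listCode l)) (ones j)) = [true] ↔ IsMinL l j := by
  rw [minC, allIdxFn_apply (oneBit_geC r) (length_nW_fstF_le r _), Function.comp_apply, fstF_boolPair, nW_pair,
    List.length_replicate, HamNP.singleton_decide_eq_true_iff, IsMinL, hl]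
  exact forall_congr' fun t => ⟨fun H ht => (geC_true_iff w k l hl h hj ht.le).1 (H ht),
    fun H ht => (geC_true_iff w k l hl h hj ht.le).2 (H ht)⟩

/-- **Value of `cntU`: the unary number of cycle-minima.** [folklore] -/
theorem cntU_pair (hl : l.length = w.length) (h : ∀ v ∈ l, v < w.length) :
    cntU r (boolPair (clInstanceCode r (w, k)) (HamNP.listCode l)) = ones (cntL l) := by
  set z := boolPair (clInstanceCode r (w, k)) (HamNP.listCode l) with hz
  have hinit : fanoutFn id (fanoutFn (lenBinF ∘ nW r) fun _ => boolPair [] []) z =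
      boolPair z (boolPair (encodeNat w.length) (boolPair (ones 0) [])) := by
    simp [hz, ones]
  rw [cntU, Function.comp_apply, Function.comp_apply, hinit,
    foldLoop_apply appF (minInd r) (by rw [eval_X]; exact length_le_pair w k _) 0 [],
    sndPow_succ_boolPair, sndPow_succ_boolPair, sndPow_zero_boolPair, foldAcc_appF, List.nil_append]
  have hcc : ccat (fun j => minInd r (boolPair z (ones (0 + j)))) w.length =
      ccat (fun j => if IsMinL l j then [true] else []) w.length := by
    refine ccat_congr fun j hj => ?_
    rw [Nat.zero_add, minInd_apply]
    by_cases hm : IsMinL l j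
    · rw [if_pos ((minC_true_iff w k l hl h hj).2 hm), if_pos hm]
    · rw [if_neg (fun h' => hm ((minC_true_iff w k l hl h hj).1 h')), if_neg hm]
  rw [hcc, ccat_indicator, cntL, hl]

end CountValues

/-! ### The inequality test and the verifier -/

/-- On `w`: `1ᵏ` (the unary threshold of the instance). [folklore] -/
def uW : List Bool → List Bool := sndF ∘ fstF
/-- On `w`: `1^{4k + 2 #minima}`. [folklore] -/
def rhsU : List Bool → List Bool :=
  appF ∘ fanoutFn (appF ∘ fanoutFn (appF ∘ fanoutFn uW uW) (appF ∘ fanoutFn uW uW))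
    (appF ∘ fanoutFn (cntU r) (cntU r))
/-- On `w`: `1^{n + 2}`. [folklore] -/
def lhsU : List Bool → List Bool := List.cons true ∘ List.cons true ∘ nW r
/-- **The genus inequality test** `[n + 2 ≤ 4k + 2 #minima]`, i.e. `|w|/2 + 1 ≤ 2k + orb`. [folklore] -/
def ineqT : List Bool → List Bool := notFn (ltLenF ∘ fanoutFn (rhsU r) (lhsU r))

/-- `uW ∈ FP`. [cite: AroraBarakCC2009, §1.3] -/
theorem uW_mem_FP : uW ∈ FP := comp_mem_FP sndF_mem_FP fstF_mem_FP
/-- `rhsU ∈ FP`. [cite: AroraBarakCC2009, §1.3] -/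
theorem rhsU_mem_FP : rhsU r ∈ FP :=
  comp_mem_FP appF_mem_FP (fanoutFn_mem_FP
    (comp_mem_FP appF_mem_FP (fanoutFn_mem_FP (comp_mem_FP appF_mem_FP (fanoutFn_mem_FP uW_mem_FP uW_mem_FP))
      (comp_mem_FP appF_mem_FP (fanoutFn_mem_FP uW_mem_FP uW_mem_FP))))
    (comp_mem_FP appF_mem_FP (fanoutFn_mem_FP (cntU_mem_FP r) (cntU_mem_FP r))))
/-- `lhsU ∈ FP`. [cite: AroraBarakCC2009, §1.3] -/
theorem lhsU_mem_FP : lhsU r ∈ FP :=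
  comp_mem_FP (cons_mem_FP true) (comp_mem_FP (cons_mem_FP true) (nW_mem_FP r))
/-- `ineqT ∈ FP`. [cite: AroraBarakCC2009, §1.3] -/
theorem ineqT_mem_FP : ineqT r ∈ FP :=
  notFn_mem_FP (comp_mem_FP ltLenF_mem_FP (fanoutFn_mem_FP (rhsU_mem_FP r) (lhsU_mem_FP r)))
/-- `ineqT` is one-bit. [folklore] -/
theorem oneBit_ineqT : OneBit (ineqT r) := oneBit_notFn (oneBit_ltLenF.comp _)

section IneqValues

variable {r}
variable (w : List (Fin r × Bool)) (k : ℕ) (l : List ℕ)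

/-- Truth of `ineqT` on a list code with `n` items below `n`. [folklore] -/
theorem ineqT_true_iff (hl : l.length = w.length) (h : ∀ v ∈ l, v < w.length) :
    ineqT r (boolPair (clInstanceCode r (w, k)) (HamNP.listCode l)) = [true] ↔
      w.length + 2 ≤ 4 * k + 2 * cntL l := by
  have hu : uW (boolPair (clInstanceCode r (w, k)) (HamNP.listCode l)) = ones k := by
    simp [uW, sndF_code]
  have hr : (rhsU r (boolPair (clInstanceCode r (w, k)) (HamNP.listCode l))).length = 4 * k + 2 * cntL l := by
    simp only [rhsU, Function.comp_apply, fanoutFn_apply, appF_boolPair, hu, cntU_pair w k l hl h,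
      List.length_append, List.length_replicate]
    omega
  have hlhs : (lhsU r (boolPair (clInstanceCode r (w, k)) (HamNP.listCode l))).length = w.length + 2 := by
    simp [lhsU]
  rw [ineqT, notFn_apply (b := decide (4 * k + 2 * cntL l < w.length + 2))]
  · simp only [List.cons.injEq, and_true, Bool.not_eq_true', decide_eq_false_iff_not, not_lt]
  · rw [Function.comp_apply, fanoutFn_apply, ltLenF_boolPair, hr, hlhs]

end IneqValues

/-- **The verifier**: the word is empty, or the certificate is a canonical list of `n` numbers below
`n` forming a fixed-point-free involution matching inverse letters, with the genus inequality.
[cite: Heuer2020, Cor 2.5] -/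
def verifT : List Bool → List Bool :=
  orFn emptyT (andFn HamNP.canYT (andFn (lenYT r) (andFn (ltT r) (andFn (invT r) (andFn (letT r) (ineqT r))))))

/-- **`verifT ∈ FP`.** [cite: AroraBarakCC2009, §1.3] -/
theorem verifT_mem_FP : verifT r ∈ FP :=
  orFn_mem_FP emptyT_mem_FP (andFn_mem_FP HamNP.canYT_mem_FP (andFn_mem_FP (lenYT_mem_FP r) (andFn_mem_FP (ltT_mem_FP r)
    (andFn_mem_FP (invT_mem_FP r) (andFn_mem_FP (letT_mem_FP r) (ineqT_mem_FP r))))))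

/-- **`verifT` is one-bit.** [folklore] -/
theorem oneBit_verifT : OneBit (verifT r) :=
  oneBit_orFn oneBit_emptyT (oneBit_andFn HamNP.oneBit_canYT (oneBit_andFn (oneBit_lenYT r) (oneBit_andFn (oneBit_ltT r)
    (oneBit_andFn (oneBit_invT r) (oneBit_andFn (oneBit_letT r) (oneBit_ineqT r))))))

/-- **The verifier language** and its membership in `P`. [cite: AroraBarakCC2009, Def. 1.13] -/
def verifLang : Language Bool := {z | verifT r z = [true]}

/-- `verifLang ∈ P`. [cite: AroraBarakCC2009, Def. 1.13 and §1.3] -/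
theorem verifLang_mem_P : verifLang r ∈ Classes.P := CliqueNP.mem_P_of_oneBit (verifT_mem_FP r) (oneBit_verifT r)

/-- **The property of the certificate list certified by the verifier** (for `w ≠ []`): `n` numbers
below `n` forming a fixed-point-free involution pairing inverse letters, with
`n + 2 ≤ 4k + 2 #cycle-minima`. [cite: Heuer2020, Cor 2.5] -/
def GoodCert {r : ℕ} (w : List (Fin r × Bool)) (k : ℕ) (l : List ℕ) : Prop :=
  ∃ (hl : l.length = w.length) (h : ∀ v ∈ l, v < w.length),
    (∀ (j : ℕ) (hj : j < l.length), l[l[j]]'(by have := h _ (List.getElem_mem hj); omega) = j ∧ l[j] ≠ j) ∧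
    (∀ (j : ℕ) (hj : j < l.length),
      w[l[j]]'(h _ (List.getElem_mem hj)) = ((w[j]'(by rw [← hl]; exact hj)).1, !(w[j]'(by rw [← hl]; exact hj)).2)) ∧
    w.length + 2 ≤ 4 * k + 2 * cntL l

/-- **Truth of the verifier on the code of any instance paired with any string.**
[cite: Heuer2020, Cor 2.5] -/
theorem verifT_code_true_iff (w : List (Fin r × Bool)) (k : ℕ) (y : List Bool) :
    verifT r (boolPair (clInstanceCode r (w, k)) y) = [true] ↔
      w = [] ∨ ∃ l : List ℕ, y = HamNP.listCode l ∧ GoodCert w k l := by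
  rw [verifT, orFn_eq_true_iff oneBit_emptyT (oneBit_andFn HamNP.oneBit_canYT (oneBit_andFn (oneBit_lenYT r)
      (oneBit_andFn (oneBit_ltT r) (oneBit_andFn (oneBit_invT r) (oneBit_andFn (oneBit_letT r) (oneBit_ineqT r)))))),
    andFn_eq_true_iff HamNP.oneBit_canYT (oneBit_andFn (oneBit_lenYT r) (oneBit_andFn (oneBit_ltT r)
      (oneBit_andFn (oneBit_invT r) (oneBit_andFn (oneBit_letT r) (oneBit_ineqT r))))),
    andFn_eq_true_iff (oneBit_lenYT r) (oneBit_andFn (oneBit_ltT r) (oneBit_andFn (oneBit_invT r)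
      (oneBit_andFn (oneBit_letT r) (oneBit_ineqT r)))),
    andFn_eq_true_iff (oneBit_ltT r) (oneBit_andFn (oneBit_invT r) (oneBit_andFn (oneBit_letT r) (oneBit_ineqT r))),
    andFn_eq_true_iff (oneBit_invT r) (oneBit_andFn (oneBit_letT r) (oneBit_ineqT r)),
    andFn_eq_true_iff (oneBit_letT r) (oneBit_ineqT r),
    emptyT_true_iff, HamNP.canYT_true_iff]
  constructor
  · rintro (h0 | ⟨⟨l, rfl⟩, hlen, hlt, hinv, hlet, hineq⟩)
    · exact Or.inl h0
    · rw [lenYT_true_iff] at hlen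
      rw [ltT_true_iff] at hlt
      rw [invT_true_iff w k l hlen hlt] at hinv
      rw [letT_true_iff w k l hlen hlt] at hlet
      rw [ineqT_true_iff w k l hlen hlt] at hineq
      exact Or.inr ⟨l, rfl, hlen, hlt, hinv, hlet, hineq⟩
  · rintro (h0 | ⟨l, rfl, hlen, hlt, hinv, hlet, hineq⟩)
    · exact Or.inl h0
    · refine Or.inr ⟨⟨l, rfl⟩, ?_, ?_, ?_, ?_, ?_⟩
      · rwa [lenYT_true_iff]
      · rwa [ltT_true_iff]
      · rwa [invT_true_iff w k l hlen hlt]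
      · rwa [letT_true_iff w k l hlen hlt]
      · rwa [ineqT_true_iff w k l hlen hlt]

end CLNP

end Literature.GroupTheory.CombinatorialGroupTheory

end
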